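import Summits.ValiantsHypothesis.ValiantsHypothesis.Theorems.BarrierLeverDefinableEquationsHighestWeightVector

/-!
# Cruxes `BarrierLever.DefinableEquations` (8745) / `SingleSizeEquations` (8749) — the WEYL
# ELEMENT on coefficient vectors (toolkit for the dominance of highest weights)

Companion to `…HighestWeightVector.lean` (design memo `HWV-NORMAL-FORM-PLAN.md`, evidence #9/#10
on stmt-ValiantsHypothesis-8749).  For the elementary unipotents `e_ab(τ) : x_b ↦ x_b + τ x_a` the
coefficient action is an explicit sparse substitution of the coefficient variables (`elemSubst`,
`eval_aeval_elemSubst`) which is UNITRIANGULAR for the `a`-th coordinate grading `c_m ↦ m_a`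
(`elemSubst_unitri`: apart from `c_m` only `c_{m'}` with `m'_a < m_a` occur).  The Weyl element
`w₀ = e_ij(1) e_ji(-1) e_ij(1)` is the substitution `x_j ↦ x_i, x_i ↦ -x_j` (`weyl_gen`,
`sAct_weyl`) and swaps the `i`-th and `j`-th coordinate tori (`sAct_weyl_torus`).  Finally a
polynomial satisfying `P(λ •_W c) = λ^μ P(c)` for all `λ, c` is `W`-isobaric of weight `μ`
(`isWeightedHomogeneous_of_torus`, coefficient extraction in `λ`).

Elementary; small definitions (`sAct`, `elemSubst` abbreviate explicit expressions), no named
facts.  HONEST FRAMING: toolkit for a normal form; nothing here bears on the open content of the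
cruxes.  References: [LandsbergGCT2017] §8; [Burgisser2000] Rem. 2.7.
-/

-- layout Summits/ValiantsHypothesis/ValiantsHypothesis forces the duplicated namespace component
set_option linter.dupNamespace false

noncomputable section

open MvPolynomial

namespace Summit.ValiantsHypothesis.ValiantsHypothesis.Theorems.BarrierLever.IsobaricEquations

open Literature.Computability.AlgebraicComplexity Literature.Barriers.ValiantsHypothesis
open Summit.ValiantsHypothesis.ValiantsHypothesis.Theorems.BarrierLever.SuccinctHittingSetsForVP
open Summit.ValiantsHypothesis.ValiantsHypothesis.Theorems.BarrierLever.BoolSumComponents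

/-! ## §15 Dominance: a `U`-invariant weight vector has monotone weight (`w_i ≤ w_j` for `i < j`) -/

section dominance

variable {n : ℕ}

/-- The coefficient action of an arbitrary substitution `g`: `c ↦ coeff (f_c ∘ g)`. [folklore] -/
def sAct [Fintype (degLEMonomials n)] (g : Fin n → MvPolynomial (Fin n) ℂ) (c : degLEMonomials n → ℂ) :
    degLEMonomials n → ℂ :=
  coeffVector (degLEMonomials n) (aeval g (ofCoeffs c))

/-- `sAct` of an elementary unipotent as an explicit sparse substitution of the coefficient
variables: `c_m ↦ Σ_{k ≤ m_a} C(m_b + k, k) τ^k c_{m - kε_a + kε_b}`. [folklore] -/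
def elemSubst (a b : Fin n) (τ : ℂ) (m : degLEMonomials n) : MvPolynomial (degLEMonomials n) ℂ :=
  ∑ k : Fin ((m : Fin n →₀ ℕ) a + 1),
    C (((((m : Fin n →₀ ℕ) b + k).choose k : ℕ) : ℂ) * τ ^ (k : ℕ)) * X (shiftMon m a b k)

variable [Fintype (degLEMonomials n)]

/-- Composition of coefficient actions for degree-preserving (affine) substitutions. [folklore] -/
theorem sAct_sAct (g h : Fin n → MvPolynomial (Fin n) ℂ) (hh : ∀ k, (h k).totalDegree ≤ 1)
    (c : degLEMonomials n → ℂ) :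
    sAct g (sAct h c) = sAct (fun k => aeval g (h k)) c := by
  unfold sAct
  rw [ofCoeffs_coeffVector _ ((totalDegree_aeval_affine_le h hh _).trans (totalDegree_ofCoeffs_le c)),
    ← AlgHom.comp_apply, comp_aeval]

omit [Fintype (degLEMonomials n)] in
/-- Elementary unipotents are affine substitutions. [folklore] -/
theorem elemU_affine (a b : Fin n) (τ : ℂ) : ∀ k, (elemU a b τ k).totalDegree ≤ 1 :=
  elemUnipotent_affine a b τ

/-- Semantics of `elemSubst` (`a ≠ b`). [folklore] -/
theorem eval_elemSubst {a b : Fin n} (hab : a ≠ b) (τ : ℂ) (c : degLEMonomials n → ℂ)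
    (m : degLEMonomials n) :
    eval c (elemSubst a b τ m) = sAct (elemU a b τ) c m := by
  rw [sAct, coeffVector_apply, coeff_aeval_elemU hab, elemSubst, map_sum, ← Fin.sum_univ_eq_sum_range]
  refine Finset.sum_congr rfl fun k _ => ?_
  rw [map_mul, eval_C, eval_X]
  exact congrArg _ (coeff_ofCoeffs c (shiftMon m a b k)).symm

/-- Evaluating after `elemSubst`. [folklore] -/
theorem eval_aeval_elemSubst {a b : Fin n} (hab : a ≠ b) (τ : ℂ) (c : degLEMonomials n → ℂ)
    (P : MvPolynomial (degLEMonomials n) ℂ) :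
    eval c (aeval (elemSubst a b τ) P) = eval (sAct (elemU a b τ) c) P := by
  have hpt : (fun m => eval c (elemSubst a b τ m)) = sAct (elemU a b τ) c := by
    funext m
    exact eval_elemSubst hab τ c m
  rw [BoolSumComponents.eval_aeval_eq, hpt]

omit [Fintype (degLEMonomials n)] in
/-- **`elemSubst a b τ` is unitriangular for the `a`-th coordinate grading** `c_m ↦ m_a`: apart from
`c_m` itself only variables `c_{m'}` with `m'_a < m_a` occur. [folklore] -/
theorem elemSubst_unitri {a b : Fin n} (hab : a ≠ b) (τ : ℂ) (m : degLEMonomials n) :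
    ∀ γ ∈ (elemSubst a b τ m - X m).support,
      Finsupp.weight (fun m : degLEMonomials n => (m : Fin n →₀ ℕ) a) γ < (m : Fin n →₀ ℕ) a := by
  classical
  intro γ hγ
  have h0 : shiftMon m a b 0 = m := by
    apply Subtype.ext
    simp [shiftMon]
  have hsplit : elemSubst a b τ m - X m = ∑ k : Fin ((m : Fin n →₀ ℕ) a),
      C (((((m : Fin n →₀ ℕ) b + k.succ).choose k.succ : ℕ) : ℂ) * τ ^ (k.succ : ℕ)) *
        X (shiftMon m a b k.succ) := by
    rw [elemSubst, Fin.sum_univ_succ, h0]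
    simp
  rw [hsplit] at hγ
  obtain ⟨k, -, hk⟩ := Finset.mem_biUnion.mp (support_sum hγ)
  rw [C_mul'] at hk
  have hk' := support_smul hk
  rw [support_X, Finset.mem_singleton] at hk'
  rw [hk', Finsupp.weight_single, smul_eq_mul, one_mul]
  show ((m : Fin n →₀ ℕ) - Finsupp.single a ((k.succ : Fin _) : ℕ) +
    Finsupp.single b ((k.succ : Fin _) : ℕ)) a < (m : Fin n →₀ ℕ) a
  have hk2 : ((k.succ : Fin ((m : Fin n →₀ ℕ) a + 1)) : ℕ) = (k : ℕ) + 1 := by simp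
  rw [Finsupp.add_apply, Finsupp.tsub_apply, Finsupp.single_apply, Finsupp.single_apply, if_pos rfl,
    if_neg (fun h => hab h.symm), hk2]
  have := k.2
  omega

omit [Fintype (degLEMonomials n)] in
/-- **The Weyl element on generators**: `e_ij(1) ∘ e_ji(-1) ∘ e_ij(1)` maps `x_j ↦ x_i`, `x_i ↦ -x_j`.
[folklore] -/
theorem weyl_gen {i j : Fin n} (hij : i ≠ j) (k : Fin n) :
    aeval (elemU i j 1) (aeval (elemU j i (-1)) (elemU i j (1 : ℂ) k)) =
      (if k = j then X i else if k = i then -X j else X k) := by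
  have he_j : elemU i j (1 : ℂ) j = X j + C 1 * X i := by rw [elemU_apply, if_pos rfl]
  have he_i : elemU i j (1 : ℂ) i = X i := by rw [elemU_apply, if_neg hij]
  have hf_i : elemU j i (-1 : ℂ) i = X i + C (-1) * X j := by rw [elemU_apply, if_pos rfl]
  have hf_j : elemU j i (-1 : ℂ) j = X j := by rw [elemU_apply, if_neg (Ne.symm hij)]
  by_cases hkj : k = j
  · subst hkj
    rw [if_pos rfl, he_j]
    simp only [map_add, map_mul, map_neg, map_one, aeval_X, hf_j, hf_i, he_j, he_i]
    ring
  · by_cases hki : k = i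
    · subst hki
      rw [if_neg hkj, if_pos rfl, he_i, aeval_X, hf_i]
      simp only [map_add, map_mul, map_neg, map_one, aeval_X, he_i, he_j]
      ring
    · rw [if_neg hkj, if_neg hki, elemU_apply, if_neg hkj, aeval_X, elemU_apply, if_neg hki, aeval_X,
        elemU_apply, if_neg hkj]

/-- **The coefficient action of the Weyl element** `w₀ = e_ij(1) e_ji(-1) e_ij(1)`:
`T_{e_ij(1)} (T_{e_ji(-1)} (T_{e_ij(1)} c)) = T_{w₀} c`. [folklore] -/
theorem sAct_weyl {i j : Fin n} (hij : i ≠ j) (c : degLEMonomials n → ℂ) :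
    sAct (elemU i j 1) (sAct (elemU j i (-1)) (sAct (elemU i j 1) c)) =
      sAct (fun k => if k = j then X i else if k = i then -X j else X k) c := by
  have haff : ∀ k, (aeval (elemU j i (-1)) (elemU i j (1 : ℂ) k)).totalDegree ≤ 1 := fun k =>
    (totalDegree_aeval_affine_le _ (elemU_affine j i (-1)) _).trans (elemU_affine i j 1 k)
  rw [sAct_sAct (elemU j i (-1)) (elemU i j 1) (elemU_affine i j 1) c,
    sAct_sAct (elemU i j 1) (fun k => aeval (elemU j i (-1)) (elemU i j (1 : ℂ) k)) haff c]
  congr 1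
  funext k
  exact weyl_gen hij k

omit [Fintype (degLEMonomials n)] in
/-- The one-parameter torus in the `l`-th variable: exponent bookkeeping. [folklore] -/
theorem torusExp_single (l : Fin n) (m : Fin n →₀ ℕ) :
    0 + ∑ k : Fin n, (if k = l then 1 else 0) * m k = m l := by
  rw [zero_add, Finset.sum_eq_single l]
  · rw [if_pos rfl, one_mul]
  · intro k _ hk; rw [if_neg hk, zero_mul]
  · intro h; exact absurd (Finset.mem_univ l) h

/-- **The Weyl element swaps the `i`-th and `j`-th coordinate tori**: scaling `c` by `t^{m_i}`
before `T_{w₀}` is scaling by `t^{m_j}` after. [folklore] -/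
theorem sAct_weyl_torus {i j : Fin n} (hij : i ≠ j) (t : ℂ) (c : degLEMonomials n → ℂ) :
    sAct (fun k => if k = j then X i else if k = i then -X j else X k)
        (fun m : degLEMonomials n => t ^ ((m : Fin n →₀ ℕ) i) * c m) =
      fun m : degLEMonomials n => t ^ ((m : Fin n →₀ ℕ) j) *
        sAct (fun k => if k = j then X i else if k = i then -X j else X k) c m := by
  -- conjugation `w₀ D_i = D_j w₀` on generators
  have hconj : ∀ g : MvPolynomial (Fin n) ℂ,
      aeval (fun k => (if k = j then X i else if k = i then -X j else X k : MvPolynomial (Fin n) ℂ))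
        (aeval (fun k => C (t ^ (if k = i then 1 else 0)) * X k) g) =
      aeval (fun k => C (t ^ (if k = j then 1 else 0)) * X k)
        (aeval (fun k => (if k = j then X i else if k = i then -X j else X k : MvPolynomial (Fin n) ℂ))
          g) := by
    intro g
    induction g using MvPolynomial.induction_on with
    | C a => simp only [aeval_C, algebraMap_eq]
    | add p q hp hq => simp only [map_add, hp, hq]
    | mul_X p k hp =>
      simp only [map_mul, hp, aeval_X]
      congr 1
      by_cases hkj : k = j
      · subst hkj; simp [hij, Ne.symm hij]
      · by_cases hki : k = i
        · subst hki; simp [hkj]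
        · simp [hkj, hki]
  funext m
  have hci : (fun m : degLEMonomials n => t ^ ((m : Fin n →₀ ℕ) i) * c m) =
      fun m : degLEMonomials n =>
        t ^ (0 + ∑ k : Fin n, (if k = i then 1 else 0) * (m : Fin n →₀ ℕ) k) * c m := by
    funext m; rw [torusExp_single]
  rw [sAct, coeffVector_apply, hci, ofCoeffs_torus, map_mul, aeval_C, algebraMap_eq, hconj,
    coeff_torusTranslate, torusExp_single, sAct, coeffVector_apply]

/-- **Isobaric from scaling**: if `P(t •_W c) = t^μ P(c)` for all `t, c`, then `P` is `W`-isobaric of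
weight `μ`. [folklore] -/
theorem isWeightedHomogeneous_of_torus {ι : Type*} (W : ι → ℕ) {P : MvPolynomial ι ℂ} {μ : ℕ}
    (h : ∀ (t : ℂ) (c : ι → ℂ), eval (fun m => t ^ W m * c m) P = t ^ μ * eval c P) :
    IsWeightedHomogeneous W P μ := by
  classical
  -- every component of weight `k ≠ μ` vanishes identically
  have hcomp : ∀ k, k ≠ μ → weightedHomogeneousComponent W k P = 0 := by
    intro k hk
    refine MvPolynomial.funext fun c => ?_
    rw [map_zero]
    set K := max (weightedTotalDegree W P) μ with hK
    have hKμ : μ ≤ K := le_max_right _ _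
    have hKW : weightedTotalDegree W P ≤ K := le_max_left _ _
    -- coefficient extraction from the orbit identity
    have hrange : ∀ k', k' ∈ Finset.range (K + 1) ∨ weightedHomogeneousComponent W k' P = 0 := by
      intro k'
      by_cases hk' : k' ≤ weightedTotalDegree W P
      · exact Or.inl (Finset.mem_range.mpr (by omega))
      · exact Or.inr (weightedHomogeneousComponent_eq_zero k' P (by omega))
    have key : ∀ t : ℂ, t ≠ 0 → ∑ k' ∈ Finset.range (K + 1), t ^ k' *
        (eval c (weightedHomogeneousComponent W k' P) - if k' = μ then eval c P else 0) = 0 := by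
      intro t _
      have h1 : ∑ k' ∈ Finset.range (K + 1), t ^ k' * (if k' = μ then eval c P else 0) =
          t ^ μ * eval c P := by
        rw [Finset.sum_eq_single μ, if_pos rfl]
        · intro k' _ hk'; rw [if_neg hk', mul_zero]
        · intro hμ; exact absurd (Finset.mem_range.mpr (by omega)) hμ
      have h2 : ∑ k' ∈ Finset.range (K + 1), t ^ k' * eval c (weightedHomogeneousComponent W k' P) =
          eval (fun m => t ^ W m * c m) P := by
        rw [Isobaric.eval_torus_eq_sum W c t P]
        refine (Finset.sum_subset (Finset.range_subset_range.mpr (by omega)) fun k' _ hk' => ?_).symm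
        rw [weightedHomogeneousComponent_eq_zero k' P, map_zero, mul_zero]
        rw [Finset.mem_range] at hk'; omega
      simp only [mul_sub, Finset.sum_sub_distrib, h1, h2, h t c, sub_self]
    rcases hrange k with hkK | hk0
    · have := eq_zero_of_sum_pow_mul_eq_zero _ K key k hkK
      rw [if_neg hk, sub_zero] at this
      exact this
    · rw [hk0, map_zero]
  intro α hα
  by_contra hne
  have h0 := hcomp _ hne
  have : coeff α (weightedHomogeneousComponent W (Finsupp.weight W α) P) = coeff α P := by
    rw [coeff_weightedHomogeneousComponent, if_pos rfl]
  rw [h0, coeff_zero] at this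
  exact hα this.symm

end dominance


end Summit.ValiantsHypothesis.ValiantsHypothesis.Theorems.BarrierLever.IsobaricEquations

end
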